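import Summits.NavierStokesRegularity.NavierStokesRegularity.Theses.FrozenSignCascade
import Summits.NavierStokesRegularity.NavierStokesRegularity.Theorems.FrozenSignCascadeBoundedEnvelopeContinuationAxisymmetricAssembly
import Summits.NavierStokesRegularity.NavierStokesRegularity.Theorems.FrozenSignCascadeBoundedEnvelopeContinuationAxisymmetricDatum
import Summits.NavierStokesRegularity.NavierStokesRegularity.Theorems.FrozenSignCascadeBoundedEnvelopeContinuationAxisDecay
import Summits.NavierStokesRegularity.NavierStokesRegularity.Theorems.FrozenSignCascadeBoundedEnvelopeContinuationShellSupBound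
import Summits.NavierStokesRegularity.NavierStokesRegularity.Theorems.FrozenSignCascadeBoundedEnvelopeContinuationAxisZoom
import HarnessLib

/-!
# Route FrozenSignCascade · crux `BoundedEnvelopeContinuation` (stmt-NavierStokesRegularity-10579)
# holds UNCONDITIONALLY for AXISYMMETRIC Clay data

Helper file for the crux item (conjunct (B) of route `FrozenSignCascade`, line `registered`);
lands `--supports` that item: the registered sub-goal `boundedEnvelopeContinuation_axisymmetric`.

**Theorem (`boundedEnvelopeContinuation_axisymmetric`).** For `ν > 0` and an AXISYMMETRIC Clay
datum `u₀` (smooth, rapidly decaying, divergence free, `u₀ (rotZ θ x) = rotZ θ (u₀ x)`): if at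
every horizon `T₀` the critical Fourier envelope `‖ξ‖² ‖V(t,ξ)‖` of all Fourier-side mild
solutions `V` on `[0,T]`, `T ≤ T₀`, from `𝓕⁻¹u₀` is bounded by one constant (the hypothesis of
crux (B)), then `u₀` launches a global smooth bounded-energy (Clay) solution. No Liouville
conjecture, no Type-I exclusion hypothesis: on the axisymmetric class the crux is a THEOREM.

**Proof** (composition of the landed sub-goals of lead c4; the analysis is in those files).
By `stub_clayOfBackwardBounded` (lead c1) it suffices that every classical Leray–Hopf solution
`(u, p)` from `u₀` on `[0,T)` is backward bounded at every final-time point `(T, x₀)`. The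
bounded envelope puts every slice in the critical Morrey class (lead c1, `stub_morreyOfEnvelope`),
`u` is axisymmetric (`axisymmetric_of_datum`, AX0: Tao-class rotation invariance and Kato
identification), and:
* OFF the axis, `(T, x₀)` is regular by the Caffarelli–Kohn–Nirenberg rotation count (tree:
  `axisymmetricL3_boundedNearTop_offAxis`, Seregin 2014 ε-regularity, proved);
* ON the axis, the viscosity-normalising zoom about `(T, x₀)` is a classical axisymmetric
  unit-viscosity solution on `(-25,0) × ℝ³` with finite Albritton–Barker Type-I quantity
  `𝐈(Q(0,5))` (`zoomBundle_axis`, AX2, built on lead c1's `exists_zoom_typeIBound_lt_top_of_morrey`),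
  hence obeys Seregin–Šverák's axis decay `|x'| ‖w‖ ≤ C` on their unit cylinder
  (`axisDecay_of_typeIBound`, AX1: Seregin–Zajaczkowski 2007 Prop. 4.1 on every shell,
  `shellSupBound_of_abScaledSum`, AX1s, with the pressure re-gauged by ball means), so the origin
  of the zoom is regular by Seregin–Šverák 2009 Thm. 3.2 (tree: `isRegularAtOrigin_of_axisDecay_holds`,
  proved: bounded away from the final time + axis decay ⇒ regular; blow-up alternative + KNSS 2009
  Thm. 5.3), i.e. `u` is backward bounded at `(T, x₀)`.
The assembly is `boundedEnvelopeContinuation_axisymmetric_of` (AX3).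

In words: an envelope-riding (Type-I, discretely self-similar, …) blow-up of an AXISYMMETRIC real
flow is impossible — the axisymmetric case of the `q = ∞` endpoint criterion, cf. Seregin–Zhou
2020 (axially symmetric `L_∞(0,T; Ḃ^{-1}_{∞,∞})` suitable weak solutions are regular; here at the
`PM² ⊂ Ḃ^{-1}_{∞,∞}` level, for classical solutions from Clay data, fully formalised).

## References

* G. Seregin, V. Šverák, Comm. PDE 34 (2009) = arXiv:0804.1803, Thm. 3.2, Prop. 3.7.
  [SereginSverak2009]
* G. Seregin, W. Zajaczkowski, SIAM J. Math. Anal. 39 (2007), Prop. 4.1. [SereginZajaczkowski2007]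
* G. Koch, N. Nadirashvili, G. Seregin, V. Šverák, Acta Math. 203 (2009), Thm. 5.3.
  [KochNadirashviliSereginSverak2009]
* G. Seregin, D. Zhou, J. Math. Sci. 244 (2020) = arXiv:1802.03600, §1. [SereginZhou2020]
* D. Albritton, T. Barker, J. Math. Fluid Mech. 21 (2019), Lemma 2.6. [AlbrittonBarker2019]
-/

noncomputable section

set_option linter.dupNamespace false -- nested layout Summit.<S>.<Sub>, Sub = S (D-0017)

open Set MeasureTheory Filter Topology Metric Function
open scoped ENNReal NNReal
open Literature.Analysis Literature.Analysis.FluidPDE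

namespace Summit.NavierStokesRegularity.NavierStokesRegularity.Theorems.BoundedEnvelope

/-- **Crux (B) `BoundedEnvelopeContinuation` holds for AXISYMMETRIC Clay data, unconditionally**
(statement and proof in the module docstring): the composition
`boundedEnvelopeContinuation_axisymmetric_of axisymmetric_of_datum
(axisDecay_of_typeIBound shellSupBound_of_abScaledSum) zoomBundle_axis` of the landed sub-goals
AX0, AX1∘AX1s, AX2, AX3 of lead c4.
[cite: SereginSverak2009, Thm. 3.2 and Prop. 3.7; SereginZajaczkowski2007, Prop. 4.1; KochNadirashviliSereginSverak2009, Thm. 5.3] -/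
theorem boundedEnvelopeContinuation_axisymmetric :
    ∀ ν : ℝ, 0 < ν → ∀ (u₀ : EuclideanSpace ℝ (Fin 3) → EuclideanSpace ℝ (Fin 3))
      (hu : ContDiff ℝ (⊤ : ℕ∞) u₀) (hd : Literature.Analysis.FluidPDE.HasRapidSpatialDecay u₀),
      Literature.Analysis.FluidPDE.NSWave0.IsDivFree u₀ →
      Literature.Analysis.FluidPDE.IsAxisymmetric u₀ →
      (∀ T₀ : ℝ, 0 < T₀ → ∃ C : ℝ, ∀ T : ℝ, T ≤ T₀ →
        ∀ V : ℝ → EuclideanSpace ℝ (Fin 3) → Fin 3 → ℂ,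
          Literature.Analysis.FluidPDE.FourierNS.IsFourierMild (4 * Real.pi ^ 2 * ν) 4 0 T V →
          V 0 = Literature.Analysis.FluidPDE.FourierNS.fourierData hu hd →
          ∀ t ∈ Set.Icc 0 T, ∀ ξ : EuclideanSpace ℝ (Fin 3), ‖ξ‖ ^ 2 * ‖V t ξ‖ ≤ C) →
      ∃ (u : ℝ → EuclideanSpace ℝ (Fin 3) → EuclideanSpace ℝ (Fin 3))
        (p : ℝ → EuclideanSpace ℝ (Fin 3) → ℝ),
        Literature.Analysis.FluidPDE.IsSmoothOnHalfSpace u ∧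
        Literature.Analysis.FluidPDE.IsSmoothOnHalfSpace p ∧
        Literature.Analysis.FluidPDE.IsNavierStokesSolution ν 0 u₀ u p ∧
        Literature.Analysis.FluidPDE.HasBoundedEnergy u :=
  boundedEnvelopeContinuation_axisymmetric_of axisymmetric_of_datum
    (axisDecay_of_typeIBound shellSupBound_of_abScaledSum) zoomBundle_axis

/-- **Corollary in summit vocabulary.** For an axisymmetric Clay datum, hypothesis (B) of the
route at that datum gives the conclusion of `NavierStokesRegularity` at that datum, i.e. the
route's deciding implication `EnvelopeBound → NavierStokesRegularity` needs NO second crux on the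
axisymmetric class: `EnvelopeBound` restricted to axisymmetric data already yields global
regularity of axisymmetric Clay data. [cite: SereginZhou2020, §1 (axially symmetric remark)] -/
theorem navierStokesRegularity_axisymmetric_of_envelopeBound
    (hA : Summit.NavierStokesRegularity.NavierStokesRegularity.Theses.FrozenSignCascade.EnvelopeBound) :
    ∀ ν : ℝ, 0 < ν → ∀ (u₀ : EuclideanSpace ℝ (Fin 3) → EuclideanSpace ℝ (Fin 3))
      (hu : ContDiff ℝ (⊤ : ℕ∞) u₀) (hd : Literature.Analysis.FluidPDE.HasRapidSpatialDecay u₀),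
      Literature.Analysis.FluidPDE.NSWave0.IsDivFree u₀ →
      Literature.Analysis.FluidPDE.IsAxisymmetric u₀ →
      ∃ (u : ℝ → EuclideanSpace ℝ (Fin 3) → EuclideanSpace ℝ (Fin 3))
        (p : ℝ → EuclideanSpace ℝ (Fin 3) → ℝ),
        Literature.Analysis.FluidPDE.IsSmoothOnHalfSpace u ∧
        Literature.Analysis.FluidPDE.IsSmoothOnHalfSpace p ∧
        Literature.Analysis.FluidPDE.IsNavierStokesSolution ν 0 u₀ u p ∧
        Literature.Analysis.FluidPDE.HasBoundedEnergy u :=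
  fun ν hν u₀ hu hd hdiv hax =>
    boundedEnvelopeContinuation_axisymmetric ν hν u₀ hu hd hdiv hax (hA ν hν u₀ hu hd hdiv)

end Summit.NavierStokesRegularity.NavierStokesRegularity.Theorems.BoundedEnvelope

end
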